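import Literature.MathematicalPhysics.QuantumLattice.HubbardWindowCertificate
import Literature.MathematicalPhysics.QuantumLattice.HubbardHubbardModel
import HarnessLib

/-!
# Window certificates for the Hubbard model on `ℤ^d` with TRANSLATIONS AND INVERSIONS
# (`x ↦ ±x + v`); the Hubbard chain and the Lieb–Wu energy

Family `hubbard` (topic `MathematicalPhysics/QuantumLattice`). Companion of
`HubbardWindowCertificate` (symmetry family: translations `τ_v`) and `HubbardWindowCertificateD4`
(`d = 2`, affine `D₄` maps). Here, in every dimension `d`, the symmetry family of a
thermodynamic-limit ("reduce"-mode) certificate is the group `{±1} ⋉ ℤ^d` of affine maps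
`x ↦ εx + v` (`ε = ±1`, `v ∈ ℤ^d`): translations (`ε = 1`) and inversions through a (half-)lattice
point (`ε = -1`). For the Hubbard CHAIN (`d = 1`) this is the full space group — translations and
the box reflection `x ↦ (ℓ - 1) - x` used by Han's bootstrap (arXiv:2006.06002 (2020) §2,
`F[U⁻¹ O U] = F[O]` for the lattice symmetries `U`) and by the reduce-mode certificates of the bundle
papers/HubbardSuperconductivity/manybody-bootstrap/ (`hypotheses.reduce.point_group`). The maps are
realised on a window by the site embeddings `PolySite.affEmb ε v Λ : Λ ↪ εΛ + v` and on every torus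
`(ℤ/Lℤ)^d` by the permutations `torusAff ε (v mod L) : y ↦ εy + v` and their Bogoliubov unitaries
`fockAff` (`fockRelabel ∘ Orb.mapEquiv`), which commute with the Hubbard Hamiltonian (parity and
translation invariance, `fermionTorusGraph_adj_neg`, `fermionTorusGraph_adj_addRight`) and preserve
the sectors. The pull-back dictionary `Γ(ι_{εΛ+v})(Γ(affEmb) A) = U (Γ(ι_Λ) A) Uᴴ`
(`fermionEmbed_toTorusEmb_affEmb`) gives the window theorem
`groundEnergyAt_div_ge_of_window_certificate_aff` (all `d`), its square-lattice thermodynamic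
limit `energyDensity2D_ge_of_window_certificate_aff`, and for the chain the per-site bound
`hubbardChain_energyPerSite_ge_of_window_certificate` on every long ring and — along the
half-filled even rings of the tree's fact `lieb_wu` — the comparison with the Lieb–Wu energy
`liebWuEnergy_ge_of_window_certificate` (`c − Σ‖aₖ‖ ≤ e_LW(U)`, conditional on `lieb_wu`).
Everything is PROVED; the definitions are bookkeeping (`affSite`, `affShiftSet`, `PolySite.affEmb`,
`torusAff`, `fockAff`).

## References
* X. Han, *Quantum many-body bootstrap*, arXiv:2006.06002 (2020), §2 eq. (2)–(8) (constraints,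
  lattice symmetries `F[U⁻¹OU] = F[O]`), §3. [cite: Han2020Bootstrap, §2–3]
* G. Benfatto, A. Giuliani, V. Mastropietro, Ann. Henri Poincaré 7 (2006) 809, §2.1 symmetry (4)
  (parity `x ↦ -x`) and §2.2 (translations) of the Hubbard model. [cite: BenfattoGiulianiMastropietro2006, §2.1–2.2]
* E. H. Lieb, F. Y. Wu, Phys. Rev. Lett. 20 (1968) 1445, eq. (20) (ground-state energy per site of
  the half-filled chain). [cite: LiebWuPRL1968, eq. (20)]
* O. Bratteli, D. W. Robinson, *Operator Algebras and Quantum Statistical Mechanics II*, 2nd ed.,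
  §5.2.2, Thm. 5.2.5 (Bogoliubov automorphisms of one-particle bijections). [cite: BratteliRobinsonII1997, §5.2.2]
-/

noncomputable section

namespace Literature.MathematicalPhysics.QuantumLattice

open Matrix Finset HubbardWave0 Literature.Probability.LatticeModels
open Literature.MathematicalPhysics.QuantumManyBody.StateRelaxation
open scoped ComplexOrder BigOperators

/-! ### Affine maps `x ↦ εx + v` of `ℤ^d` on regions -/

section Regions

variable {d : ℕ}

/-- The affine map `x ↦ εx + v` of `ℤ^d`, `ε = ±1`: a translation (`ε = 1`) or the inversion
through `v/2` (`ε = -1`). [cite: BenfattoGiulianiMastropietro2006, §2.1–2.2] -/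
def affSite (ε : ℤˣ) (v : Site d) (x : Site d) : Site d := fun i => (ε : ℤ) * x i + v i

/-- `affSite` coordinatewise. [folklore] -/
@[simp] theorem affSite_apply (ε : ℤˣ) (v x : Site d) (i : Fin d) :
    affSite ε v x i = (ε : ℤ) * x i + v i := rfl

/-- `x ↦ εx + v` is injective. [folklore] -/
theorem affSite_injective (ε : ℤˣ) (v : Site d) : Function.Injective (affSite ε v) := by
  intro x y h
  funext i
  have hi : (ε : ℤ) * x i + v i = (ε : ℤ) * y i + v i := congrFun h i
  exact Int.eq_of_mul_eq_mul_left (Units.ne_zero ε) (add_right_cancel hi)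

/-- The image region `εΛ + v = {εx + v : x ∈ Λ}`. [folklore] -/
def affShiftSet (ε : ℤˣ) (v : Site d) (Λ : Finset (Site d)) : Finset (Site d) :=
  Λ.map ⟨affSite ε v, affSite_injective ε v⟩

/-- `εx + v ∈ εΛ + v` for `x ∈ Λ`. [folklore] -/
theorem affSite_mem_affShiftSet (ε : ℤˣ) (v : Site d) {Λ : Finset (Site d)} {x : Site d}
    (hx : x ∈ Λ) : affSite ε v x ∈ affShiftSet ε v Λ :=
  Finset.mem_map.2 ⟨x, hx, rfl⟩

/-- **The affine map of a region as an injection of ordered site sets**, `x ↦ εx + v` from the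
sites of `Λ` to those of `εΛ + v`. [cite: BenfattoGiulianiMastropietro2006, §2.1–2.2] -/
def PolySite.affEmb (ε : ℤˣ) (v : Site d) (Λ : Finset (Site d)) :
    PolySite Λ ↪ PolySite (affShiftSet ε v Λ) :=
  ⟨fun y => PolySite.pt (affSite ε v (ofLex y.1)) (affSite_mem_affShiftSet ε v (PolySite.ofLex_mem y)),
    fun y y' hy => by
      have h : affSite ε v (ofLex y.1) = affSite ε v (ofLex y'.1) :=
        congrArg (fun z : PolySite (affShiftSet ε v Λ) => ofLex z.1) hy
      exact Subtype.ext (congrArg toLex (affSite_injective ε v h))⟩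

/-- The underlying site of `affEmb ε v Λ y`. [folklore] -/
@[simp] theorem PolySite.ofLex_coe_affEmb (ε : ℤˣ) (v : Site d) {Λ : Finset (Site d)}
    (y : PolySite Λ) : ofLex (PolySite.affEmb ε v Λ y).1 = affSite ε v (ofLex y.1) := rfl

/-! ### Checking the window hypotheses (for concrete windows) -/

/-- `[-1,1]^d`: `thicken {0} 1 = box d 1` (so that `h0 : thicken {0} 1 ⊆ Λ'` of the window theorems is
a finite check). [folklore] -/
theorem thicken_singleton_zero_one : thicken ({0} : Finset (Site d)) 1 = box d 1 := by
  ext x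
  simp [thicken]

/-- Coordinate spreads grow by at most `2` from `Λ` to `thicken Λ 1`. [folklore] -/
theorem abs_sub_le_of_mem_thicken_one {Λ : Finset (Site d)} {M : ℕ}
    (hΛ : ∀ x ∈ Λ, ∀ y ∈ Λ, ∀ j, |x j - y j| ≤ (M : ℤ)) {x y : Site d}
    (hx : x ∈ thicken Λ 1) (hy : y ∈ thicken Λ 1) (j : Fin d) : |x j - y j| ≤ (M : ℤ) + 2 := by
  simp only [thicken, Nat.floor_one, Finset.mem_biUnion, Finset.mem_image] at hx hy
  obtain ⟨x₀, hx₀, vx, hvx, rfl⟩ := hx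
  obtain ⟨y₀, hy₀, vy, hvy, rfl⟩ := hy
  rw [mem_box] at hvx hvy
  have h1 := hΛ x₀ hx₀ y₀ hy₀ j
  rw [abs_le] at h1 ⊢
  simp only [Pi.add_apply, Nat.cast_one] at hvx hvy ⊢
  constructor <;> linarith [(hvx j).1, (hvx j).2, (hvy j).1, (hvy j).2, h1.1, h1.2]

/-- **`x ↦ x mod L` is injective on `thicken Λ 1` as soon as `L ≥ M + 3`**, `M` a bound on the
coordinate spreads of `Λ` (so that `hInj` of the window theorems holds for ALL large `L` after one
finite check on `Λ`). [folklore] -/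
theorem injOn_proj_thicken_one_of_spread {Λ : Finset (Site d)} {M : ℕ}
    (hΛ : ∀ x ∈ Λ, ∀ y ∈ Λ, ∀ j, |x j - y j| ≤ (M : ℤ)) {L : ℕ} (hL : M + 3 ≤ L) :
    Set.InjOn (Torus.proj (d := d) L) ↑(thicken Λ 1) := by
  intro x hx y hy hxy
  have hML : (M : ℤ) + 2 < L := by exact_mod_cast (show M + 2 < L by omega)
  exact Torus.proj_injective_of_abs_sub_lt
    (fun j => lt_of_le_of_lt (abs_sub_le_of_mem_thicken_one hΛ hx hy j) hML) hxy

end Regions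

/-! ### The maps `y ↦ εy + v` of the discrete torus -/

section TorusMaps

variable {d L : ℕ}

/-- `ε² = 1` in `ℤ/Lℤ` for `ε = ±1`. [folklore] -/
private theorem cast_units_mul_self (ε : ℤˣ) : ((ε : ℤ) : ZMod L) * ((ε : ℤ) : ZMod L) = 1 := by
  rw [← Int.cast_mul, ← Units.val_mul, Int.units_mul_self, Units.val_one, Int.cast_one]

/-- **The affine map `y ↦ εy + v` of the discrete torus `(ℤ/Lℤ)^d`** (`ε = ±1`), a permutation.
[cite: BenfattoGiulianiMastropietro2006, §2.1–2.2] -/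
def torusAff (ε : ℤˣ) (v : TorusSite d L) : Equiv.Perm (TorusSite d L) where
  toFun y := fun i => ((ε : ℤ) : ZMod L) * y i + v i
  invFun y := fun i => ((ε : ℤ) : ZMod L) * (y i - v i)
  left_inv y := by
    funext i
    simp only
    rw [add_sub_cancel_right, ← mul_assoc, cast_units_mul_self, one_mul]
  right_inv y := by
    funext i
    simp only
    rw [← mul_assoc, cast_units_mul_self, one_mul, sub_add_cancel]

/-- `torusAff ε v y = εy + v` coordinatewise. [folklore] -/
@[simp] theorem torusAff_apply (ε : ℤˣ) (v y : TorusSite d L) (i : Fin d) :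
    torusAff ε v y i = ((ε : ℤ) : ZMod L) * y i + v i := rfl

/-- `(εx + v) mod L = ε (x mod L) + (v mod L)`. [folklore] -/
theorem Torus.proj_affSite (L : ℕ) (ε : ℤˣ) (v x : Site d) :
    Torus.proj L (affSite ε v x) = torusAff ε (Torus.proj L v) (Torus.proj L x) := by
  funext i
  simp [Torus.proj, Int.cast_add, Int.cast_mul]

/-- `ε = 1`: `torusAff 1 v` is the translation `y ↦ y + v`. [folklore] -/
theorem torusAff_one (v : TorusSite d L) : torusAff 1 v = Equiv.addRight v := by
  refine Equiv.ext fun y => funext fun i => ?_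
  rw [torusAff_apply, Units.val_one, Int.cast_one, one_mul]
  rfl

/-- `ε = -1`: `torusAff (-1) v` is the parity `y ↦ -y` followed by the translation by `v`. [folklore] -/
theorem torusAff_neg_one (v : TorusSite d L) :
    torusAff (-1) v = Equiv.addRight v * Equiv.neg (TorusSite d L) := by
  refine Equiv.ext fun y => funext fun i => ?_
  rw [torusAff_apply, Units.val_neg, Units.val_one, Int.cast_neg, Int.cast_one, neg_one_mul]
  rfl

end TorusMaps

/-! ### The Bogoliubov unitaries of `y ↦ εy + v` and the pull-back dictionary -/

section Torus

variable {d L : ℕ} [NeZero L]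

/-- **`y ↦ εy + v` is an automorphism of the nearest-neighbour torus graph** (parity and
translation invariance). [cite: BenfattoGiulianiMastropietro2006, §2.1 symmetry (4) and §2.2] -/
theorem fermionTorusGraph_adj_torusAff (ε : ℤˣ) (v : TorusSite d L) (x y : FermionTorus d L) :
    (fermionTorusGraph d L).Adj (FermionTorus.ofTorusEquiv (torusAff ε v) x)
        (FermionTorus.ofTorusEquiv (torusAff ε v) y) ↔ (fermionTorusGraph d L).Adj x y := by
  rcases Int.units_eq_one_or ε with rfl | rfl
  · rw [torusAff_one]
    exact fermionTorusGraph_adj_addRight v x y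
  · rw [torusAff_neg_one, FermionTorus.ofTorusEquiv_mul, Equiv.Perm.mul_apply, Equiv.Perm.mul_apply,
      fermionTorusGraph_adj_addRight]
    exact fermionTorusGraph_adj_neg x y

/-- **Invariance of the Hubbard Hamiltonian of the torus under `y ↦ εy + v`.**
[cite: BenfattoGiulianiMastropietro2006, §2.1 symmetry (4) and §2.2] -/
theorem relabel_torusAff_hubbardTorus (ε : ℤˣ) (v : TorusSite d L) (t U : ℝ) :
    relabel (Orb.mapEquiv (FermionTorus.ofTorusEquiv (torusAff ε v))) (hubbardTorus d L t U) =
      hubbardTorus d L t U :=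
  relabel_hamiltonian _ _ _ (fermionTorusGraph_adj_torusAff ε v) t U

/-- (Local to this file, as in `HubbardWindowCertificate`: the orbital-generic lemmas carry the
order-derived `DecidableEq` of the torus sites.) [folklore] -/
local instance (priority := high) instDecidableEqFermionTorusAff : DecidableEq (FermionTorus d L) :=
  LinearOrder.toDecidableEq

/-- **The Bogoliubov unitary `U_{ε,v}` of `y ↦ εy + v`** on `Fock (Orb (FermionTorus d L))`
(`fockRelabel` of the induced orbital permutation; `ε = 1`: the translation unitary).
[cite: BratteliRobinsonII1997, §5.2.2, Thm. 5.2.5] -/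
abbrev fockAff (ε : ℤˣ) (v : TorusSite d L) :=
  fockRelabel (Orb.mapEquiv (FermionTorus.ofTorusEquiv (torusAff ε v)))

/-- The conjugation action of `U_{ε,v}` is the relabelling by `y ↦ εy + v`. [folklore] -/
theorem fockAff_conj (ε : ℤˣ) (v : TorusSite d L)
    (Z : Matrix (Finset (Orb (FermionTorus d L))) (Finset (Orb (FermionTorus d L))) ℂ) :
    (fockAff ε v).val * Z * (fockAff ε v).valᴴ =
      relabel (Orb.mapEquiv (FermionTorus.ofTorusEquiv (torusAff ε v))) Z :=
  (relabel_eq_fockRelabel_conj _ Z).symm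

/-- `U_{ε,v}` commutes with the Hubbard Hamiltonian of the torus. [cite: BenfattoGiulianiMastropietro2006, §2.1–2.2] -/
theorem fockAff_mul_hubbardTorus (ε : ℤˣ) (v : TorusSite d L) (t U : ℝ) :
    (fockAff ε v).val * hubbardTorus d L t U = hubbardTorus d L t U * (fockAff ε v).val :=
  (fockRelabel_commute_of_relabel_eq _ (relabel_torusAff_hubbardTorus ε v t U)).eq

/-- `U_{ε,v}` preserves the joint sectors. [folklore] -/
theorem fockAff_mulVec_mem_szSector (ε : ℤˣ) (v : TorusSite d L) {N : ℕ} {M : ℝ}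
    {ψ : Fock (Orb (FermionTorus d L))} (hψ : ψ ∈ szSector N M) :
    (fockAff ε v).val *ᵥ ψ ∈ szSector N M :=
  fockRelabel_mapEquiv_mulVec_mem_szSector _ hψ

/-- `U_πᴴ = U_{π⁻¹}` for relabelling unitaries. [folklore] -/
theorem fockRelabel_val_conjTranspose {ι : Type*} [LinearOrder ι] [Fintype ι] (π : Equiv.Perm ι) :
    (fockRelabel π).valᴴ = (fockRelabel π.symm).val := by
  rw [fockRelabel_symm]
  rfl

/-- `U_{ε,v}ᴴ` preserves the joint sectors. [folklore] -/
theorem fockAff_conjTranspose_mulVec_mem_szSector (ε : ℤˣ) (v : TorusSite d L) {N : ℕ} {M : ℝ}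
    {ψ : Fock (Orb (FermionTorus d L))} (hψ : ψ ∈ szSector N M) :
    (fockAff ε v).valᴴ *ᵥ ψ ∈ szSector N M := by
  show (fockRelabel (Orb.mapEquiv (FermionTorus.ofTorusEquiv (torusAff ε v)))).valᴴ *ᵥ ψ ∈ szSector N M
  rw [fockRelabel_val_conjTranspose, Orb.mapEquiv_symm]
  exact fockRelabel_mapEquiv_mulVec_mem_szSector _ hψ

/-- `U_{ε,v}ᴴ U_{ε,v} = 1`. [folklore] -/
theorem fockAff_conjTranspose_mul_self (ε : ℤˣ) (v : TorusSite d L) :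
    (fockAff ε v).valᴴ * (fockAff ε v).val = 1 := by
  have h := fockRelabel_conjTranspose_mul_self (Orb.mapEquiv (FermionTorus.ofTorusEquiv (torusAff (L := L) ε v)))
  rw [← fockRelabel_val] at h
  exact h

/-- **Pulling the affine image of a region back into the torus is the torus image of the
pull-back**: `Γ(ι_{εΛ+v,L})(Γ(affEmb ε v) A) = U_{ε, v mod L} (Γ(ι_{Λ,L}) A) U_{ε, v mod L}ᴴ`
(as the relabelling automorphism). [cite: BratteliRobinsonII1997, §5.2.2, Thm. 5.2.5] -/
theorem fermionEmbed_toTorusEmb_affEmb (ε : ℤˣ) (v : Site d) {Λ : Finset (Site d)}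
    (h : Set.InjOn (Torus.proj (d := d) L) ↑Λ)
    (h' : Set.InjOn (Torus.proj (d := d) L) ↑(affShiftSet ε v Λ)) (A : FermionOp Λ) :
    fermionEmbed (PolySite.toTorusEmb L h') (fermionEmbed (PolySite.affEmb ε v Λ) A) =
      relabel (Orb.mapEquiv (FermionTorus.ofTorusEquiv (torusAff ε (Torus.proj L v))))
        (fermionEmbed (PolySite.toTorusEmb L h) A) := by
  have key : (PolySite.affEmb ε v Λ).trans (PolySite.toTorusEmb L h') =
      (PolySite.toTorusEmb L h).trans
        (FermionTorus.ofTorusEquiv (torusAff ε (Torus.proj L v))).toEmbedding := by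
    refine DFunLike.ext _ _ fun y => ?_
    rw [Function.Embedding.trans_apply, Function.Embedding.trans_apply, PolySite.toTorusEmb_apply,
      PolySite.toTorusEmb_apply, Equiv.coe_toEmbedding, FermionTorus.ofTorusEquiv_ofTorusSite,
      PolySite.ofLex_coe_affEmb, Torus.proj_affSite]
  rw [fermionEmbed_fermionEmbed, key, ← fermionEmbed_fermionEmbed, fermionEmbed_equiv]
  rfl

/-- **Affine differences in the window become symmetry defects on the torus**:
`Γ(ι_{Λ'})(Γ(incl)(Γ(affEmb ε v) Y) − Γ(incl) Y) = U (Γ(ι_Λ) Y) Uᴴ − Γ(ι_Λ) Y`, `U = U_{ε, v mod L}`.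
Han 2020 §2 (`F[U⁻¹ O U] = F[O]` for lattice symmetries `U`). [cite: Han2020Bootstrap, §2] -/
theorem fermionEmbed_toTorusEmb_aff_sub {Λ Λ' : Finset (Site d)} (hΛ : Λ ⊆ Λ') (ε : ℤˣ)
    (v : Site d) (hsh : affShiftSet ε v Λ ⊆ Λ') (hInj' : Set.InjOn (Torus.proj (d := d) L) ↑Λ')
    (Y : FermionOp Λ) :
    fermionEmbed (PolySite.toTorusEmb L hInj')
        (fermionEmbed (PolySite.incl hsh) (fermionEmbed (PolySite.affEmb ε v Λ) Y) -
          fermionEmbed (PolySite.incl hΛ) Y) =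
      (fockAff ε (Torus.proj L v)).val *
          fermionEmbed (PolySite.toTorusEmb L (hInj'.mono (by exact_mod_cast hΛ))) Y *
          (fockAff ε (Torus.proj L v)).valᴴ -
        fermionEmbed (PolySite.toTorusEmb L (hInj'.mono (by exact_mod_cast hΛ))) Y := by
  rw [map_sub, fermionEmbed_toTorusEmb_incl hsh hInj', fermionEmbed_toTorusEmb_incl hΛ hInj',
    fermionEmbed_toTorusEmb_affEmb ε v (hInj'.mono (by exact_mod_cast hΛ)) (hInj'.mono (by exact_mod_cast hsh)) Y,
    fockAff_conj]

end Torus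

/-! ### The window certificate with affine (`x ↦ εx + v`) reductions -/

section Window

variable {d L : ℕ} [NeZero L]

/-- (Local to this section.) [folklore] -/
local instance (priority := high) instDecidableEqFermionTorusAff' : DecidableEq (FermionTorus d L) :=
  LinearOrder.toDecidableEq

/-- **Window certificate with affine reductions ⇒ energy per site of a torus** (every `d`). As
`groundEnergyAt_div_ge_of_window_certificate` (HubbardWindowCertificate), with the symmetry family
of affine maps `x ↦ εₗx + vₗ`, `εₗ = ±1` (translations `εₗ = 1`; inversions `εₗ = -1`, e.g. the box
reflection `x ↦ (ℓ−1) − x` of a chain window `[0, ℓ−1]`): the window identity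
`Γ(incl) E_Φ − c·1 − Σ_σ μ_σ (n_{0σ} − ν·1) = Σ Λₐᵦ Oₐᴴ O_b + (Σₖ (H_{Λ'} Bₖ − Bₖ H_{Λ'})
   + Σₗ (Γ(incl)(Γ(affEmb εₗ vₗ) Yₗ) − Γ(incl) Yₗ) + Σⱼ bⱼ • wⱼ) + (Σₘ dₘ • (Vₘᴴ − Vₘ) + Σₖ aₖ • vₖ)`
(`εₗΛ + vₗ ⊆ Λ'`) proves, for every `L ≥ 3` with `x ↦ x mod L` injective on `thicken Λ' 1` and every
`n ≤ L^d`, `c − Σₖ ‖aₖ‖ + (Σ_σ μ_σ)(n/L^d − ν) ≤ groundEnergyAt (fermionTorusGraph d L) t U (2n) / L^d`.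
Han 2020 §2 (constraints (2)–(8): positivity, `F[[H,O]] = 0`, `F[U⁻¹OU] = F[O]`, charges, density).
[cite: Han2020Bootstrap, §2–3] -/
theorem groundEnergyAt_div_ge_of_window_certificate_aff (t U : ℝ) (hL : 3 ≤ L) {nh : ℕ}
    (hn : nh ≤ Fintype.card (FermionTorus d L))
    {Λ Λ' : Finset (Site d)} (hΛ : Λ ⊆ Λ')
    (hclosed : ∀ x ∈ Λ, ∀ i : Fin d, x + unitVec i ∈ Λ' ∧ x - unitVec i ∈ Λ')
    (h0 : thicken ({0} : Finset (Site d)) 1 ⊆ Λ') (hz : (0 : Site d) ∈ Λ')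
    (hInj : Set.InjOn (Torus.proj (d := d) L) ↑(thicken Λ' 1))
    (μ : Fin 2 → ℝ) (ν : ℝ)
    {m : Type*} [Fintype m] [DecidableEq m] {Λm : Matrix m m ℂ} (hΛm : Λm.PosSemidef)
    (O : m → FermionOp Λ')
    {κ : Type*} (s : Finset κ) (B : κ → FermionOp Λ)
    {ι : Type*} (tt : Finset ι) (ε : ι → ℤˣ) (v : ι → Site d) (hsh : ∀ l, affShiftSet (ε l) (v l) Λ ⊆ Λ')
    (Y : ι → FermionOp Λ)
    {γ : Type*} (u : Finset γ) (b : γ → ℂ) (cw : γ → List (Orb (PolySite Λ') × Bool))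
    (hcw : ∀ j ∈ u, ladderCharge (cw j) ≠ 0 ∨ ladderSpinCharge (cw j) ≠ 0)
    {δ : Type*} (ah : Finset δ) (dc : δ → ℝ) (V : δ → FermionOp Λ')
    {κ'' : Type*} (w : Finset κ'') (a : κ'' → ℂ) (word : κ'' → List (Orb (PolySite Λ') × Bool)) {c : ℝ}
    (hcert : fermionEmbed (PolySite.incl h0) ((hubbardFermionInteraction d t U).meanEnergyObs 1) -
        (c : ℂ) • (1 : FermionOp Λ') -
        ∑ σ : Fin 2, ((μ σ : ℝ) : ℂ) • (nAt 0 hz σ - ((ν : ℝ) : ℂ) • (1 : FermionOp Λ')) =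
      gramForm Λm O +
        (∑ k ∈ s, ((hubbardFermionInteraction d t U).localHamiltonian Λ' * fermionEmbed (PolySite.incl hΛ) (B k) -
            fermionEmbed (PolySite.incl hΛ) (B k) * (hubbardFermionInteraction d t U).localHamiltonian Λ') +
          ∑ l ∈ tt, (fermionEmbed (PolySite.incl (hsh l)) (fermionEmbed (PolySite.affEmb (ε l) (v l) Λ) (Y l)) -
            fermionEmbed (PolySite.incl hΛ) (Y l)) +
          ∑ j ∈ u, b j • ladderWord (cw j)) +
        (∑ m' ∈ ah, ((dc m' : ℝ) : ℂ) • ((V m')ᴴ - V m') + ∑ k ∈ w, a k • ladderWord (word k))) :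
    c - ∑ k ∈ w, ‖a k‖ + (∑ σ : Fin 2, μ σ) * ((nh : ℝ) / (L : ℝ) ^ d - ν) ≤
      groundEnergyAt (fermionTorusGraph d L) t U (2 * nh) / (L : ℝ) ^ d := by
  -- the pull-back homomorphism and its restrictions
  have hInj' : Set.InjOn (Torus.proj (d := d) L) ↑Λ' := hInj.mono (by exact_mod_cast subset_thicken Λ' 1)
  have hInjΛ : Set.InjOn (Torus.proj (d := d) L) ↑Λ := hInj'.mono (by exact_mod_cast hΛ)
  have hInj0 : Set.InjOn (Torus.proj (d := d) L) ↑(thicken ({0} : Finset (Site d)) 1) :=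
    hInj'.mono (by exact_mod_cast h0)
  set Γ' := fermionEmbed (PolySite.toTorusEmb L hInj') with hΓ'
  set ΓΛ := fermionEmbed (PolySite.toTorusEmb L hInjΛ) with hΓΛ
  set H := hubbardTorus d L t U with hH
  set EΦ := (hubbardFermionInteraction d t U).meanEnergyObs 1 with hEΦ
  -- the objective: `Γ' (Γ(incl) E_Φ) = Γ(ι₀) E_Φ`, whose translates sum to `H`
  set X := Γ' (fermionEmbed (PolySite.incl h0) EΦ) with hX
  have hX0 : X = fermionEmbed (PolySite.toTorusEmb L hInj0) EΦ := fermionEmbed_toTorusEmb_incl h0 hInj' EΦ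
  have hsum : ∑ v' : TorusSite d L, (fockTranslate v').val * X * (fockTranslate v').valᴴ = H := by
    rw [hX0]
    have h := sum_relabel_translate_hubbard_meanEnergyObs (d := d) t U hL
    simp_rw [relabel_eq_fockRelabel_conj] at h
    exact h
  -- density observables
  set D : Fin 2 → Matrix (Finset (Orb (FermionTorus d L))) (Finset (Orb (FermionTorus d L))) ℂ :=
    fun σ => numberOp (FermionTorus.ofTorusSite (0 : TorusSite d L)) σ with hD
  set G : Fin 2 → Matrix (Finset (Orb (FermionTorus d L))) (Finset (Orb (FermionTorus d L))) ℂ :=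
    fun σ => ∑ y : FermionTorus d L, numberOp y σ with hG
  have hDΓ : ∀ σ, Γ' (nAt 0 hz σ) = D σ := fun σ => fermionEmbed_toTorusEmb_nAt_zero hz hInj' σ
  have hDsum : ∀ σ ∈ (Finset.univ : Finset (Fin 2)),
      ∑ v' : TorusSite d L, (fockTranslate v').val * D σ * (fockTranslate v').valᴴ = G σ :=
    fun σ _ => sum_conj_fockTranslate_numberOp 0 σ
  have hGh : ∀ σ ∈ (Finset.univ : Finset (Fin 2)), (G σ).IsHermitian := fun σ _ => isHermitian_sum_numberOp σ
  have hGs : ∀ σ ∈ (Finset.univ : Finset (Fin 2)),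
      ∀ ψ ∈ (szSector (2 * nh) 0 : Submodule ℂ (Fock (Orb (FermionTorus d L)))),
        G σ *ᵥ ψ = (((nh : ℝ) : ℝ) : ℂ) • ψ := by
    intro σ _ ψ hψ
    rw [hG, spinNumber_mulVec_of_mem_szSector σ hψ]
    congr 1
    push_cast
    ring
  -- symmetry family: affine maps `x ↦ εx + v`
  set Us : ι → Matrix (Finset (Orb (FermionTorus d L))) (Finset (Orb (FermionTorus d L))) ℂ :=
    fun l => (fockAff (ε l) (Torus.proj L (v l))).val with hUs
  set Yt : ι → Matrix (Finset (Orb (FermionTorus d L))) (Finset (Orb (FermionTorus d L))) ℂ :=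
    fun l => ΓΛ (Y l) with hYt
  have hU : ∀ l ∈ tt, Us l * H = H * Us l := fun l _ => fockAff_mul_hubbardTorus _ _ t U
  have hUK : ∀ l ∈ tt, ∀ ψ ∈ (szSector (2 * nh) 0 : Submodule ℂ (Fock (Orb (FermionTorus d L)))),
      Us l *ᵥ ψ ∈ (szSector (2 * nh) 0 : Submodule ℂ (Fock (Orb (FermionTorus d L)))) :=
    fun l _ ψ hψ => fockAff_mulVec_mem_szSector _ _ hψ
  have hUK' : ∀ l ∈ tt, ∀ ψ ∈ (szSector (2 * nh) 0 : Submodule ℂ (Fock (Orb (FermionTorus d L)))),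
      (Us l)ᴴ *ᵥ ψ ∈ (szSector (2 * nh) 0 : Submodule ℂ (Fock (Orb (FermionTorus d L)))) :=
    fun l _ ψ hψ => fockAff_conjTranspose_mulVec_mem_szSector _ _ hψ
  have hUU : ∀ l ∈ tt, (Us l)ᴴ * Us l = 1 := fun l _ => fockAff_conjTranspose_mul_self _ _
  -- charge family (charged words as commutators with `N̂` / `S^z`)
  set emb : Orb (PolySite Λ') × Bool → Orb (FermionTorus d L) × Bool :=
    fun p => (Orb.embMap (PolySite.toTorusEmb L hInj') p.1, p.2) with hemb
  set C : γ → Matrix (Finset (Orb (FermionTorus d L))) (Finset (Orb (FermionTorus d L))) ℂ :=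
    fun j => if ladderCharge ((cw j).map emb) ≠ 0 then totalNumber else HubbardWave0.spinZ with hC
  set W : γ → Matrix (Finset (Orb (FermionTorus d L))) (Finset (Orb (FermionTorus d L))) ℂ :=
    fun j => (b j / (if ladderCharge ((cw j).map emb) ≠ 0 then ((ladderCharge ((cw j).map emb) : ℤ) : ℂ)
      else ((ladderSpinCharge ((cw j).map emb) : ℤ) : ℂ) / 2)) • ladderWord ((cw j).map emb) with hW
  have hHc := hamiltonian_isHermitian_and_commute_holds (fermionTorusGraph d L) t U
  have hC1 : ∀ j ∈ u, C j * H = H * C j := by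
    intro j _
    by_cases hq : ladderCharge ((cw j).map emb) ≠ 0
    · simp only [hC, hq, ne_eq, not_false_eq_true, if_true]; exact hHc.2.1.symm.eq
    · simp only [hC, hq, if_false]; exact hHc.2.2.symm.eq
  have hCK : ∀ j ∈ u, ∀ ψ ∈ (szSector (2 * nh) 0 : Submodule ℂ (Fock (Orb (FermionTorus d L)))),
      C j *ᵥ ψ ∈ (szSector (2 * nh) 0 : Submodule ℂ (Fock (Orb (FermionTorus d L)))) := by
    intro j _ ψ hψ
    obtain ⟨hNψ, hSψ⟩ := (mem_szSector_iff _ _ ψ).1 hψ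
    by_cases hq : ladderCharge ((cw j).map emb) ≠ 0
    · simp only [hC, hq, ne_eq, not_false_eq_true, if_true]
      rw [totalNumber_mulVec_of_isNParticle hNψ]
      exact Submodule.smul_mem _ _ hψ
    · simp only [hC, hq, if_false]
      rw [hSψ]
      exact Submodule.smul_mem _ _ hψ
  have hCh : ∀ j, (C j)ᴴ = C j := by
    intro j
    by_cases hq : ladderCharge ((cw j).map emb) ≠ 0
    · simp only [hC, hq, ne_eq, not_false_eq_true, if_true]
      rw [totalNumber_eq_numberDiag_univ]
      exact numberDiag_conjTranspose _
    · simp only [hC, hq, if_false]; exact HubbardWave0.spinZ_isHermitian.eq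
  have hCK' : ∀ j ∈ u, ∀ ψ ∈ (szSector (2 * nh) 0 : Submodule ℂ (Fock (Orb (FermionTorus d L)))),
      (C j)ᴴ *ᵥ ψ ∈ (szSector (2 * nh) 0 : Submodule ℂ (Fock (Orb (FermionTorus d L)))) :=
    fun j hj ψ hψ => by rw [hCh j]; exact hCK j hj ψ hψ
  have hcharged : ∀ j ∈ u, Γ' (b j • ladderWord (cw j)) = C j * W j - W j * C j := by
    intro j hj
    rw [map_smul, hΓ', fermionEmbed_ladderWord]
    have hl : ladderCharge ((cw j).map emb) ≠ 0 ∨ ladderSpinCharge ((cw j).map emb) ≠ 0 := by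
      rw [hemb, ladderCharge_map_embMap, ladderSpinCharge_map_embMap]; exact hcw j hj
    exact smul_ladderWord_eq_commutator_of_charged (b j) _ hl
  -- residual words
  set M : κ'' → Matrix (Finset (Orb (FermionTorus d L))) (Finset (Orb (FermionTorus d L))) ℂ :=
    fun k => ladderWord ((word k).map emb) with hM
  have hMc : ∀ k ∈ w, (M k).IsContraction := fun k _ => by
    rw [hM]; dsimp only; rw [ladderWord_eq_prod]; exact isContraction_prod_ladder _
  -- the identity, pulled back into the torus
  have htorus : X - (c : ℂ) • (1 : Matrix (Finset (Orb (FermionTorus d L))) (Finset (Orb (FermionTorus d L))) ℂ) -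
      ∑ σ ∈ (Finset.univ : Finset (Fin 2)), ((μ σ : ℝ) : ℂ) • (D σ - ((ν : ℝ) : ℂ) •
        (1 : Matrix (Finset (Orb (FermionTorus d L))) (Finset (Orb (FermionTorus d L))) ℂ)) =
      gramForm Λm (fun i => Γ' (O i)) +
        (∑ k ∈ s, (H * Γ' (fermionEmbed (PolySite.incl hΛ) (B k)) - Γ' (fermionEmbed (PolySite.incl hΛ) (B k)) * H) +
          ∑ l ∈ tt, (Us l * Yt l * (Us l)ᴴ - Yt l) +
          ∑ i ∈ (∅ : Finset (Fin 0)), ((0 : Matrix _ _ ℂ) * ((0 : Matrix _ _ ℂ) - (((0 : ℝ) : ℝ) : ℂ) • 1) +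
            ((0 : Matrix _ _ ℂ) - (((0 : ℝ) : ℝ) : ℂ) • 1) * (0 : Matrix _ _ ℂ)) +
          ∑ j ∈ u, (C j * W j - W j * C j)) +
        (∑ m' ∈ ah, ((dc m' : ℝ) : ℂ) • ((Γ' (V m'))ᴴ - Γ' (V m')) + ∑ k ∈ w, a k • M k) := by
    have key := congrArg Γ' hcert
    -- left-hand side
    rw [map_sub, map_sub, map_smul, map_one, map_sum] at key
    have hlhs : ∑ σ : Fin 2, Γ' (((μ σ : ℝ) : ℂ) • (nAt 0 hz σ - ((ν : ℝ) : ℂ) • (1 : FermionOp Λ'))) =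
        ∑ σ ∈ (Finset.univ : Finset (Fin 2)), ((μ σ : ℝ) : ℂ) • (D σ - ((ν : ℝ) : ℂ) •
          (1 : Matrix (Finset (Orb (FermionTorus d L))) (Finset (Orb (FermionTorus d L))) ℂ)) :=
      Finset.sum_congr rfl fun σ _ => by rw [map_smul, map_sub, map_smul, map_one, hDΓ]
    rw [hlhs] at key
    -- right-hand side, family by family
    have h1 : Γ' (∑ k ∈ s, ((hubbardFermionInteraction d t U).localHamiltonian Λ' * fermionEmbed (PolySite.incl hΛ) (B k) -
        fermionEmbed (PolySite.incl hΛ) (B k) * (hubbardFermionInteraction d t U).localHamiltonian Λ')) =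
        ∑ k ∈ s, (H * Γ' (fermionEmbed (PolySite.incl hΛ) (B k)) - Γ' (fermionEmbed (PolySite.incl hΛ) (B k)) * H) := by
      rw [map_sum]
      refine Finset.sum_congr rfl fun k _ => ?_
      rw [hH, hΓ', hubbardTorus_commutator_fermionEmbed L t U hΛ hclosed hInj (B k)]
    have h2 : Γ' (∑ l ∈ tt, (fermionEmbed (PolySite.incl (hsh l)) (fermionEmbed (PolySite.affEmb (ε l) (v l) Λ) (Y l)) -
        fermionEmbed (PolySite.incl hΛ) (Y l))) = ∑ l ∈ tt, (Us l * Yt l * (Us l)ᴴ - Yt l) := by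
      rw [map_sum]
      refine Finset.sum_congr rfl fun l _ => ?_
      rw [hUs, hYt, hΓΛ, hΓ']
      exact fermionEmbed_toTorusEmb_aff_sub hΛ (ε l) (v l) (hsh l) hInj' (Y l)
    have h3 : Γ' (∑ j ∈ u, b j • ladderWord (cw j)) = ∑ j ∈ u, (C j * W j - W j * C j) := by
      rw [map_sum]
      exact Finset.sum_congr rfl hcharged
    have h4 : Γ' (∑ m' ∈ ah, ((dc m' : ℝ) : ℂ) • ((V m')ᴴ - V m')) =
        ∑ m' ∈ ah, ((dc m' : ℝ) : ℂ) • ((Γ' (V m'))ᴴ - Γ' (V m')) := by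
      rw [map_sum]
      refine Finset.sum_congr rfl fun m' _ => ?_
      rw [map_smul, map_sub, hΓ', fermionEmbed_conjTranspose]
    have h5 : Γ' (∑ k ∈ w, a k • ladderWord (word k)) = ∑ k ∈ w, a k • M k := by
      rw [map_sum]
      refine Finset.sum_congr rfl fun k _ => ?_
      rw [map_smul, hM, hΓ', fermionEmbed_ladderWord]
    rw [hX, key, map_add, map_add, map_add, map_add, map_add, hΓ', fermionEmbed_gramForm, ← hΓ', h1, h2, h3, h4, h5,
      Finset.sum_empty, add_zero]
  -- apply the torus theorem
  have hmain := hubbardTorus_groundEnergyAt_div_ge_of_local_certificate t U hn X hsum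
    (Finset.univ : Finset (Fin 2)) μ (fun _ => ν) (fun _ => (nh : ℝ)) D G hDsum hGh hGs hΛm
    (fun i => Γ' (O i)) s (fun k => Γ' (fermionEmbed (PolySite.incl hΛ) (B k))) tt Us Yt hU hUK hUK' hUU
    (∅ : Finset (Fin 0)) (fun _ => 0) (fun _ => 0) (fun _ => 0) (fun _ => 0)
    (fun i hi => absurd hi (Finset.notMem_empty i)) (fun i hi => absurd hi (Finset.notMem_empty i))
    u C W hC1 hCK hCK' ah dc (fun m' => Γ' (V m')) w a M hMc htorus
  have hs : ∑ σ ∈ (Finset.univ : Finset (Fin 2)), μ σ * ((nh : ℝ) / (L : ℝ) ^ d - ν) =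
      (∑ σ : Fin 2, μ σ) * ((nh : ℝ) / (L : ℝ) ^ d - ν) := by rw [Finset.sum_mul]
  rw [hs] at hmain
  exact hmain

/-! ### Thermodynamic limit (`d = 2`) -/

/-- **Window certificate with affine reductions ⇒ thermodynamic-limit energy density (square
lattice).** With the data of `groundEnergyAt_div_ge_of_window_certificate_aff` in `d = 2` and target
density `n ∈ [0, 2)` (`ν = n/2`, `U ≥ 0`): `c − Σₖ ‖aₖ‖ ≤ energyDensity2D t U n` (along
`N_L = 2⌊nL²/2⌋`, `exists_forall_le_injOn_proj`, `energyDensity2D_ge_of_eventually_ge_torus`). For the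
full square-lattice point group use `energyDensity2D_ge_of_window_certificate_d4`; this version
covers translations and the rotation by `π` (`x ↦ -x + v`). [cite: Han2020Bootstrap, §3] -/
theorem energyDensity2D_ge_of_window_certificate_aff (t : ℝ) {U : ℝ} (hU : 0 ≤ U) {n : ℝ} (hn0 : 0 ≤ n)
    (hn2 : n < 2)
    {Λ Λ' : Finset (Site 2)} (hΛ : Λ ⊆ Λ')
    (hclosed : ∀ x ∈ Λ, ∀ i : Fin 2, x + unitVec i ∈ Λ' ∧ x - unitVec i ∈ Λ')
    (h0 : thicken ({0} : Finset (Site 2)) 1 ⊆ Λ') (hz : (0 : Site 2) ∈ Λ')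
    (μ : Fin 2 → ℝ)
    {m : Type*} [Fintype m] [DecidableEq m] {Λm : Matrix m m ℂ} (hΛm : Λm.PosSemidef)
    (O : m → FermionOp Λ')
    {κ : Type*} (s : Finset κ) (B : κ → FermionOp Λ)
    {ι : Type*} (tt : Finset ι) (ε : ι → ℤˣ) (v : ι → Site 2) (hsh : ∀ l, affShiftSet (ε l) (v l) Λ ⊆ Λ')
    (Y : ι → FermionOp Λ)
    {γ : Type*} (u : Finset γ) (b : γ → ℂ) (cw : γ → List (Orb (PolySite Λ') × Bool))
    (hcw : ∀ j ∈ u, ladderCharge (cw j) ≠ 0 ∨ ladderSpinCharge (cw j) ≠ 0)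
    {δ : Type*} (ah : Finset δ) (dc : δ → ℝ) (V : δ → FermionOp Λ')
    {κ'' : Type*} (w : Finset κ'') (a : κ'' → ℂ) (word : κ'' → List (Orb (PolySite Λ') × Bool)) {c : ℝ}
    (hcert : fermionEmbed (PolySite.incl h0) ((hubbardFermionInteraction 2 t U).meanEnergyObs 1) -
        (c : ℂ) • (1 : FermionOp Λ') -
        ∑ σ : Fin 2, ((μ σ : ℝ) : ℂ) • (nAt 0 hz σ - ((n / 2 : ℝ) : ℂ) • (1 : FermionOp Λ')) =
      gramForm Λm O +
        (∑ k ∈ s, ((hubbardFermionInteraction 2 t U).localHamiltonian Λ' * fermionEmbed (PolySite.incl hΛ) (B k) -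
            fermionEmbed (PolySite.incl hΛ) (B k) * (hubbardFermionInteraction 2 t U).localHamiltonian Λ') +
          ∑ l ∈ tt, (fermionEmbed (PolySite.incl (hsh l)) (fermionEmbed (PolySite.affEmb (ε l) (v l) Λ) (Y l)) -
            fermionEmbed (PolySite.incl hΛ) (Y l)) +
          ∑ j ∈ u, b j • ladderWord (cw j)) +
        (∑ m' ∈ ah, ((dc m' : ℝ) : ℂ) • ((V m')ᴴ - V m') + ∑ k ∈ w, a k • ladderWord (word k))) :
    c - ∑ k ∈ w, ‖a k‖ ≤ ThermodynamicLimit.energyDensity2D t U n := by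
  obtain ⟨L₀, hL₀⟩ := exists_forall_le_injOn_proj (thicken Λ' 1)
  refine ThermodynamicLimit.energyDensity2D_ge_of_eventually_ge_torus t hU hn0 hn2
    (μ := (∑ σ : Fin 2, μ σ) / 2) ?_
  filter_upwards [Filter.eventually_ge_atTop (max L₀ 3)] with L hL
  have hL3 : 3 ≤ L := le_trans (le_max_right _ _) hL
  have hLL : L₀ ≤ L := le_trans (le_max_left _ _) hL
  haveI : NeZero L := ⟨by omega⟩
  set nh : ℕ := ⌊n * (L : ℝ) ^ 2 / 2⌋₊ with hnh
  have hrect : ThermodynamicLimit.rectN n L = 2 * nh := rfl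
  have hn : nh ≤ Fintype.card (FermionTorus 2 L) := by
    have h := ThermodynamicLimit.rectN_le_two_mul hn0 hn2.le L
    rw [hrect] at h
    have hcard : Fintype.card (FermionTorus 2 L) = L ^ 2 := by simp [FermionTorus]
    rw [hcard, sq]
    omega
  have hmain := groundEnergyAt_div_ge_of_window_certificate_aff t U hL3 hn hΛ hclosed h0 hz (hL₀ L hLL) μ (n / 2)
    hΛm O s B tt ε v hsh Y u b cw hcw ah dc V w a word hcert
  have key : c - ∑ k ∈ w, ‖a k‖ + (∑ σ : Fin 2, μ σ) / 2 * ((((2 * nh : ℕ) : ℝ)) / (L : ℝ) ^ 2 - n) =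
      c - ∑ k ∈ w, ‖a k‖ + (∑ σ : Fin 2, μ σ) * ((nh : ℝ) / (L : ℝ) ^ 2 - n / 2) := by
    push_cast
    ring
  rw [hrect, key]
  exact hmain


/-! ### The Hubbard chain: every long ring, and the Lieb–Wu energy -/

/-- **Window certificate ⇒ energy per site of the Hubbard ring** (`d = 1`; symmetry family:
translations and reflections `x ↦ εx + v` of `ℤ`, the full space group of the chain). For every ring
length `L ≥ 3` with `x ↦ x mod L` injective on `thicken Λ' 1` and every `n ≤ L`:
`c − Σₖ ‖aₖ‖ + (Σ_σ μ_σ)(n/L − ν) ≤ energyPerSite (hubbardChain L) t U (2n)`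
(`hubbardChain L = fermionTorusGraph 1 L`, `energyPerSite = groundEnergyAt / L`). Han 2020 §2
(1D Hubbard bootstrap, Fig. 1, compared with Lieb–Wu). [cite: Han2020Bootstrap, §2] -/
theorem hubbardChain_energyPerSite_ge_of_window_certificate (t U : ℝ) (hL : 3 ≤ L) {nh : ℕ}
    (hn : nh ≤ L)
    {Λ Λ' : Finset (Site 1)} (hΛ : Λ ⊆ Λ')
    (hclosed : ∀ x ∈ Λ, ∀ i : Fin 1, x + unitVec i ∈ Λ' ∧ x - unitVec i ∈ Λ')
    (h0 : thicken ({0} : Finset (Site 1)) 1 ⊆ Λ') (hz : (0 : Site 1) ∈ Λ')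
    (hInj : Set.InjOn (Torus.proj (d := 1) L) ↑(thicken Λ' 1))
    (μ : Fin 2 → ℝ) (ν : ℝ)
    {m : Type*} [Fintype m] [DecidableEq m] {Λm : Matrix m m ℂ} (hΛm : Λm.PosSemidef)
    (O : m → FermionOp Λ')
    {κ : Type*} (s : Finset κ) (B : κ → FermionOp Λ)
    {ι : Type*} (tt : Finset ι) (ε : ι → ℤˣ) (v : ι → Site 1) (hsh : ∀ l, affShiftSet (ε l) (v l) Λ ⊆ Λ')
    (Y : ι → FermionOp Λ)
    {γ : Type*} (u : Finset γ) (b : γ → ℂ) (cw : γ → List (Orb (PolySite Λ') × Bool))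
    (hcw : ∀ j ∈ u, ladderCharge (cw j) ≠ 0 ∨ ladderSpinCharge (cw j) ≠ 0)
    {δ : Type*} (ah : Finset δ) (dc : δ → ℝ) (V : δ → FermionOp Λ')
    {κ'' : Type*} (w : Finset κ'') (a : κ'' → ℂ) (word : κ'' → List (Orb (PolySite Λ') × Bool)) {c : ℝ}
    (hcert : fermionEmbed (PolySite.incl h0) ((hubbardFermionInteraction 1 t U).meanEnergyObs 1) -
        (c : ℂ) • (1 : FermionOp Λ') -
        ∑ σ : Fin 2, ((μ σ : ℝ) : ℂ) • (nAt 0 hz σ - ((ν : ℝ) : ℂ) • (1 : FermionOp Λ')) =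
      gramForm Λm O +
        (∑ k ∈ s, ((hubbardFermionInteraction 1 t U).localHamiltonian Λ' * fermionEmbed (PolySite.incl hΛ) (B k) -
            fermionEmbed (PolySite.incl hΛ) (B k) * (hubbardFermionInteraction 1 t U).localHamiltonian Λ') +
          ∑ l ∈ tt, (fermionEmbed (PolySite.incl (hsh l)) (fermionEmbed (PolySite.affEmb (ε l) (v l) Λ) (Y l)) -
            fermionEmbed (PolySite.incl hΛ) (Y l)) +
          ∑ j ∈ u, b j • ladderWord (cw j)) +
        (∑ m' ∈ ah, ((dc m' : ℝ) : ℂ) • ((V m')ᴴ - V m') + ∑ k ∈ w, a k • ladderWord (word k))) :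
    c - ∑ k ∈ w, ‖a k‖ + (∑ σ : Fin 2, μ σ) * ((nh : ℝ) / (L : ℝ) - ν) ≤
      energyPerSite (hubbardChain L) t U (2 * nh) := by
  have hcard : Fintype.card (FermionTorus 1 L) = L := by simp [FermionTorus]
  have hn' : nh ≤ Fintype.card (FermionTorus 1 L) := by rw [hcard]; exact hn
  have hmain := groundEnergyAt_div_ge_of_window_certificate_aff t U hL hn' hΛ hclosed h0 hz hInj μ ν hΛm O s B
    tt ε v hsh Y u b cw hcw ah dc V w a word hcert
  rw [pow_one] at hmain
  rw [energyPerSite, hcard]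
  exact hmain

/-- **Half-filled even rings, in the shape of the bundle's ring-wise thermodynamic-limit rows**
(`HubbardCertifiedBounds.sdp_lower_TL_*`: `q ≤ E₀(L, N = L)/L` for every even `L ≥ L₀`): with density
constraints `n_{0σ} − ½·1` the multiplier term vanishes at `N = L = 2·(L/2)`, and the window identity
gives `c − Σₖ ‖aₖ‖ ≤ groundEnergyAt (fermionTorusGraph 1 L) t U L / L` for every EVEN `L ≥ 3` with
`x ↦ x mod L` injective on `thicken Λ' 1` (for all `L ≥ spread(Λ') + 3`:
`injOn_proj_thicken_one_of_spread`). Han 2020 §2 (1D bootstrap vs. Lieb–Wu). [cite: Han2020Bootstrap, §2] -/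
theorem hubbardChain_groundEnergyAt_div_ge_of_window_certificate (t U : ℝ) (hL : 3 ≤ L) (hLe : Even L)
    {Λ Λ' : Finset (Site 1)} (hΛ : Λ ⊆ Λ')
    (hclosed : ∀ x ∈ Λ, ∀ i : Fin 1, x + unitVec i ∈ Λ' ∧ x - unitVec i ∈ Λ')
    (h0 : thicken ({0} : Finset (Site 1)) 1 ⊆ Λ') (hz : (0 : Site 1) ∈ Λ')
    (hInj : Set.InjOn (Torus.proj (d := 1) L) ↑(thicken Λ' 1))
    (μ : Fin 2 → ℝ)
    {m : Type*} [Fintype m] [DecidableEq m] {Λm : Matrix m m ℂ} (hΛm : Λm.PosSemidef)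
    (O : m → FermionOp Λ')
    {κ : Type*} (s : Finset κ) (B : κ → FermionOp Λ)
    {ι : Type*} (tt : Finset ι) (ε : ι → ℤˣ) (v : ι → Site 1) (hsh : ∀ l, affShiftSet (ε l) (v l) Λ ⊆ Λ')
    (Y : ι → FermionOp Λ)
    {γ : Type*} (u : Finset γ) (b : γ → ℂ) (cw : γ → List (Orb (PolySite Λ') × Bool))
    (hcw : ∀ j ∈ u, ladderCharge (cw j) ≠ 0 ∨ ladderSpinCharge (cw j) ≠ 0)
    {δ : Type*} (ah : Finset δ) (dc : δ → ℝ) (V : δ → FermionOp Λ')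
    {κ'' : Type*} (w : Finset κ'') (a : κ'' → ℂ) (word : κ'' → List (Orb (PolySite Λ') × Bool)) {c : ℝ}
    (hcert : fermionEmbed (PolySite.incl h0) ((hubbardFermionInteraction 1 t U).meanEnergyObs 1) -
        (c : ℂ) • (1 : FermionOp Λ') -
        ∑ σ : Fin 2, ((μ σ : ℝ) : ℂ) • (nAt 0 hz σ - ((1 / 2 : ℝ) : ℂ) • (1 : FermionOp Λ')) =
      gramForm Λm O +
        (∑ k ∈ s, ((hubbardFermionInteraction 1 t U).localHamiltonian Λ' * fermionEmbed (PolySite.incl hΛ) (B k) -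
            fermionEmbed (PolySite.incl hΛ) (B k) * (hubbardFermionInteraction 1 t U).localHamiltonian Λ') +
          ∑ l ∈ tt, (fermionEmbed (PolySite.incl (hsh l)) (fermionEmbed (PolySite.affEmb (ε l) (v l) Λ) (Y l)) -
            fermionEmbed (PolySite.incl hΛ) (Y l)) +
          ∑ j ∈ u, b j • ladderWord (cw j)) +
        (∑ m' ∈ ah, ((dc m' : ℝ) : ℂ) • ((V m')ᴴ - V m') + ∑ k ∈ w, a k • ladderWord (word k))) :
    c - ∑ k ∈ w, ‖a k‖ ≤ groundEnergyAt (fermionTorusGraph 1 L) t U L / (L : ℝ) := by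
  obtain ⟨nh, hnh⟩ := hLe
  have hn : nh ≤ L := by omega
  have h2 : 2 * nh = L := by omega
  have hmain := hubbardChain_energyPerSite_ge_of_window_certificate t U hL hn hΛ hclosed h0 hz hInj μ (1 / 2) hΛm
    O s B tt ε v hsh Y u b cw hcw ah dc V w a word hcert
  have hcard : Fintype.card (FermionTorus 1 L) = L := by simp [FermionTorus]
  rw [energyPerSite, hcard, h2] at hmain
  have hLr : (L : ℝ) = 2 * (nh : ℝ) := by exact_mod_cast h2.symm
  have hnh0 : (nh : ℝ) ≠ 0 := Nat.cast_ne_zero.2 (by omega)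
  have key : (nh : ℝ) / (L : ℝ) - 1 / 2 = 0 := by
    rw [hLr]
    field_simp
    ring
  rw [key, mul_zero, add_zero] at hmain
  exact hmain

/-- **Window certificate at half filling ⇒ lower bound on the Lieb–Wu energy** (conditional on the
tree's fact `lieb_wu`, Lieb–Wu 1968 eq. (20): `E₀(L = 2n, N = 2n)/2n → e_LW(U)` along even rings;
see the rigour status recorded at `lieb_wu`). With hopping `t = 1`, `U > 0`, density constraints
`n_{0σ} − ½·1` and the data of `hubbardChain_energyPerSite_ge_of_window_certificate`:
`c − Σₖ ‖aₖ‖ ≤ liebWuEnergy U = −4 ∫₀^∞ J₀(ω)J₁(ω)/(ω(1 + e^{ωU/2})) dω`. This is the shape in which a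
certified 1D bootstrap bound is compared with the Bethe-ansatz value (Han 2020 §2, Fig. 1).
[cite: Han2020Bootstrap, §2] [cite: LiebWuPRL1968, eq. (20)] -/
theorem liebWuEnergy_ge_of_window_certificate (hlw : lieb_wu) {U : ℝ} (hU : 0 < U)
    {Λ Λ' : Finset (Site 1)} (hΛ : Λ ⊆ Λ')
    (hclosed : ∀ x ∈ Λ, ∀ i : Fin 1, x + unitVec i ∈ Λ' ∧ x - unitVec i ∈ Λ')
    (h0 : thicken ({0} : Finset (Site 1)) 1 ⊆ Λ') (hz : (0 : Site 1) ∈ Λ')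
    (μ : Fin 2 → ℝ)
    {m : Type*} [Fintype m] [DecidableEq m] {Λm : Matrix m m ℂ} (hΛm : Λm.PosSemidef)
    (O : m → FermionOp Λ')
    {κ : Type*} (s : Finset κ) (B : κ → FermionOp Λ)
    {ι : Type*} (tt : Finset ι) (ε : ι → ℤˣ) (v : ι → Site 1) (hsh : ∀ l, affShiftSet (ε l) (v l) Λ ⊆ Λ')
    (Y : ι → FermionOp Λ)
    {γ : Type*} (u : Finset γ) (b : γ → ℂ) (cw : γ → List (Orb (PolySite Λ') × Bool))
    (hcw : ∀ j ∈ u, ladderCharge (cw j) ≠ 0 ∨ ladderSpinCharge (cw j) ≠ 0)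
    {δ : Type*} (ah : Finset δ) (dc : δ → ℝ) (V : δ → FermionOp Λ')
    {κ'' : Type*} (w : Finset κ'') (a : κ'' → ℂ) (word : κ'' → List (Orb (PolySite Λ') × Bool)) {c : ℝ}
    (hcert : fermionEmbed (PolySite.incl h0) ((hubbardFermionInteraction 1 1 U).meanEnergyObs 1) -
        (c : ℂ) • (1 : FermionOp Λ') -
        ∑ σ : Fin 2, ((μ σ : ℝ) : ℂ) • (nAt 0 hz σ - ((1 / 2 : ℝ) : ℂ) • (1 : FermionOp Λ')) =
      gramForm Λm O +
        (∑ k ∈ s, ((hubbardFermionInteraction 1 1 U).localHamiltonian Λ' * fermionEmbed (PolySite.incl hΛ) (B k) -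
            fermionEmbed (PolySite.incl hΛ) (B k) * (hubbardFermionInteraction 1 1 U).localHamiltonian Λ') +
          ∑ l ∈ tt, (fermionEmbed (PolySite.incl (hsh l)) (fermionEmbed (PolySite.affEmb (ε l) (v l) Λ) (Y l)) -
            fermionEmbed (PolySite.incl hΛ) (Y l)) +
          ∑ j ∈ u, b j • ladderWord (cw j)) +
        (∑ m' ∈ ah, ((dc m' : ℝ) : ℂ) • ((V m')ᴴ - V m') + ∑ k ∈ w, a k • ladderWord (word k))) :
    c - ∑ k ∈ w, ‖a k‖ ≤ Literature.Analysis.FunctionSpaces.liebWuEnergy U := by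
  obtain ⟨L₀, hL₀⟩ := exists_forall_le_injOn_proj (thicken Λ' 1)
  refine ge_of_tendsto (hlw U hU).1 ?_
  filter_upwards [Filter.eventually_ge_atTop (max L₀ 2)] with n hn
  have hn2 : 2 ≤ n := le_trans (le_max_right _ _) hn
  have hnL : L₀ ≤ 2 * n := le_trans (le_trans (le_max_left _ _) hn) (by omega)
  haveI : NeZero (2 * n) := ⟨by omega⟩
  have hmain := hubbardChain_energyPerSite_ge_of_window_certificate (L := 2 * n) 1 U (by omega) (nh := n)
    (by omega) hΛ hclosed h0 hz (hL₀ (2 * n) hnL) μ (1 / 2) hΛm O s B tt ε v hsh Y u b cw hcw ah dc V w a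
    word hcert
  have hn0 : (n : ℝ) ≠ 0 := by positivity
  have key : (n : ℝ) / ((2 * n : ℕ) : ℝ) - 1 / 2 = 0 := by
    push_cast
    field_simp
    ring
  rw [key, mul_zero, add_zero] at hmain
  exact hmain

end Window

end Literature.MathematicalPhysics.QuantumLattice
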